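import Summits.Ventures.PercRepro.Night2GoodTwoD2Arith

/-!
# night-2: a covered lossy big set has at least eight distance-2 targets

For the three thin faces `Q.erase wᵢ` let `Aᵢ` be the points of `G` off the hyperplane `clF (Q.erase wᵢ)` other
than `wᵢ`: `|Aᵢ| = mᵢ − 1 ≥ 1`, at most one `|Aᵢ| = 1` (at most one fat closure), the `Aᵢ` are pairwise disjoint
(a common point would be a good point), and `(x, x') ∈ Aᵢ × Aⱼ` (`i ≠ j`) is a distance-2 pair.  The targets
`Q ∪ {x, x'}` of the three products `Aₐ × A_b`, `Aₐ × A_c`, `A_b × A_c` are pairwise distinct, so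
`|d2Targets Q| ≥ |Aₐ||A_b| + |Aₐ||A_c| + |A_b||A_c| ≥ 1·2 + 1·2 + 2·2 = 8`.
-/

namespace PercRepro.Shadow

open PercRepro.ThmH PercRepro.PerFlat

variable {α : Type*} [DecidableEq α] {M : Matroid α} [M.Finite] {G : Finset α}

omit [DecidableEq α] in
/-- The arithmetic: three numbers `≥ 1`, no two equal to `1`, have pairwise products summing to `≥ 8`. -/
theorem eight_le_sum_products_aux {a b c : ℕ} (ha : 1 ≤ a) (hb : 1 ≤ b) (hc : 1 ≤ c)
    (h1 : ¬ (a = 1 ∧ b = 1)) (h2 : ¬ (a = 1 ∧ c = 1)) (h3 : ¬ (b = 1 ∧ c = 1)) :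
    8 ≤ a * b + a * c + b * c := by
  rcases Nat.lt_or_ge a 2 with ha1 | ha2
  · have ha' : a = 1 := by omega
    have hb2 : 2 ≤ b := by
      by_contra hlt
      exact h1 ⟨ha', by omega⟩
    have hc2 : 2 ≤ c := by
      by_contra hlt
      exact h2 ⟨ha', by omega⟩
    have := Nat.mul_le_mul hb2 hc2
    rw [ha', one_mul, one_mul]
    omega
  · rcases Nat.lt_or_ge b 2 with hb1 | hb2
    · have hb' : b = 1 := by omega
      have hc2 : 2 ≤ c := by
        by_contra hlt
        exact h3 ⟨hb', by omega⟩
      have := Nat.mul_le_mul ha2 hc2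
      rw [hb', mul_one, one_mul]
      omega
    · have h4 := Nat.mul_le_mul ha2 hb2
      have h5 := Nat.mul_le_mul ha2 hc
      have h6 := Nat.mul_le_mul hb2 hc
      omega

/-- Two two-point extensions of `Q` by points outside `Q` coincide only if the pairs coincide. -/
theorem pair_of_insert_insert_eq {Q : Finset α} {x x' y y' : α} (hx : x ∉ Q) (hx' : x' ∉ Q)
    (heq : insert x (insert x' Q) = insert y (insert y' Q)) :
    (x = y ∨ x = y') ∧ (x' = y ∨ x' = y') := by
  have h1 : x ∈ insert y (insert y' Q) := heq ▸ Finset.mem_insert_self x _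
  have h2 : x' ∈ insert y (insert y' Q) := heq ▸ Finset.mem_insert_of_mem (Finset.mem_insert_self x' Q)
  simp only [Finset.mem_insert] at h1 h2
  constructor
  · rcases h1 with h | h | h
    · exact Or.inl h
    · exact Or.inr h
    · exact absurd h hx
  · rcases h2 with h | h | h
    · exact Or.inl h
    · exact Or.inr h
    · exact absurd h hx'

/-- **At least eight distance-2 targets** for a covered lossy big pair (at most one fat closure). -/
theorem eight_le_card_d2Targets (hG : G ∈ flatsQ M (5 + 1)) (hd : (gr M \ G).card = 2)
    (hk : kColoops M G = 1) (hs : ∀ e ∈ gr M, ∀ f ∈ gr M, e ≠ f → rkN M {e, f} = 2)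
    (hl : ∀ e ∈ gr M, M.Indep {e}) (hfat : (fatClosures M 5 G 2).card ≤ 1) {B : Finset α}
    (hB : B ∈ thinMembers M 5 G) (hbig : 5 ≤ (B \ coloops M G).card) {z : α} (hz : z ∈ G \ clF M B)
    (h : loss M 5 G B z ≠ 0) (hno : ¬ (gtPts M 5 G (insert z B)).Nonempty) :
    8 ≤ (d2Targets M 5 G (insert z B)).card := by
  have hd' : (gr M \ G).card ≤ 5 := by omega
  have hGg : G ⊆ gr M := (mem_flatsQ.1 hG).1
  have hQG : insert z B ⊆ G :=
    Finset.insert_subset (Finset.mem_sdiff.1 hz).1 (subset_G_of_mem_thinMembers hB)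
  have hfaces := thinFacesOf_eq_image_erase hG hd hk hs hl hB hbig hz h
  have h3 := card_coloops_eq_three_of_loss_ne_zero hG hd hk hs hl hB hbig hz h
  obtain ⟨wa, wb, wc, hab, hac, hbc, hcol⟩ := Finset.card_eq_three.1 h3
  have hmem : ∀ w ∈ ({wa, wb, wc} : Finset α), w ∈ coloops M (insert z B \ coloops M G) := by
    intro w hw; rw [hcol]; exact hw
  have hface : ∀ w ∈ coloops M (insert z B \ coloops M G),
      (insert z B).erase w ∈ thinFacesOf M 5 G (insert z B) := by
    intro w hw
    rw [hfaces]
    exact Finset.mem_image_of_mem _ hw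
  have herase_ne : ∀ w w' : α, w ∈ insert z B → w ≠ w' → (insert z B).erase w ≠ (insert z B).erase w' := by
    intro w w' hwQ hne heq
    have hmem' : w ∈ (insert z B).erase w' := Finset.mem_erase.2 ⟨hne, hwQ⟩
    rw [← heq] at hmem'
    exact (Finset.mem_erase.1 hmem').1 rfl
  -- the sets `A w`
  have hAmem : ∀ w ∈ coloops M (insert z B \ coloops M G),
      ∀ x ∈ (G \ clF M ((insert z B).erase w)).erase w,
        x ∈ G \ insert z B ∧ x ∉ clF M ((insert z B).erase w) := by
    intro w hw x hx
    rw [Finset.mem_erase, Finset.mem_sdiff] at hx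
    refine ⟨Finset.mem_sdiff.2 ⟨hx.2.1, fun hxQ => hx.2.2 ?_⟩, hx.2.2⟩
    exact subset_clF_of_subset_gr ((Finset.erase_subset _ _).trans (hQG.trans hGg))
      (Finset.mem_erase.2 ⟨hx.1, hxQ⟩)
  have hAcard : ∀ w ∈ coloops M (insert z B \ coloops M G),
      ((G \ clF M ((insert z B).erase w)).erase w).card + 1 = (G \ clF M ((insert z B).erase w)).card := by
    intro w hw
    have hwG : w ∈ G := hQG (Finset.mem_sdiff.1 (mem_coloops.1 hw).1).1
    have hwcl : w ∉ clF M ((insert z B).erase w) :=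
      (mem_coloops.1 (mem_coloops_of_mem_coloops_sdiff hG hk hQG hw)).2
    rw [Finset.card_erase_of_mem (Finset.mem_sdiff.2 ⟨hwG, hwcl⟩)]
    have := Finset.card_pos.2 ⟨w, Finset.mem_sdiff.2 ⟨hwG, hwcl⟩⟩
    omega
  have hAge1 : ∀ w ∈ coloops M (insert z B \ coloops M G),
      1 ≤ ((G \ clF M ((insert z B).erase w)).erase w).card := by
    intro w hw
    have hthin := mem_thinMembers_of_mem_thinFacesOf (hface w hw)
    have hm := two_le_card_sdiff_of_not_lay0 hG hd' (mem_thinMembers.1 hthin).1 (mem_thinMembers.1 hthin).2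
    have := hAcard w hw
    omega
  -- disjointness: a common point would be a good point
  have hAdisj : ∀ w ∈ coloops M (insert z B \ coloops M G), ∀ w' ∈ coloops M (insert z B \ coloops M G),
      w ≠ w' → Disjoint ((G \ clF M ((insert z B).erase w)).erase w)
        ((G \ clF M ((insert z B).erase w')).erase w') := by
    intro w hw w' hw' hne
    rw [Finset.disjoint_left]
    intro x hx hx'
    have h1 := hAmem w hw x hx
    have h2 := hAmem w' hw' x hx'
    have hwQ : w ∈ insert z B := (Finset.mem_sdiff.1 (mem_coloops.1 hw).1).1
    exact h2.2 (mem_clF_of_not_gtPts hG hd hk hs hl hB hbig hz h hno h1.1 (hface w hw) h1.2 (hface w' hw')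
      (herase_ne w' w ((Finset.mem_sdiff.1 (mem_coloops.1 hw').1).1) hne.symm))
  -- at most one fat face
  have hfat1 := card_fat_faces_le_one hG hd hk hs hl hfat hB hbig hz h
  have hnot2 : ∀ w ∈ coloops M (insert z B \ coloops M G), ∀ w' ∈ coloops M (insert z B \ coloops M G),
      w ≠ w' → ¬ (((G \ clF M ((insert z B).erase w)).erase w).card = 1 ∧
        ((G \ clF M ((insert z B).erase w')).erase w').card = 1) := by
    intro w hw w' hw' hne hboth
    have hc := hAcard w hw
    have hc' := hAcard w' hw'
    have hwQ : w ∈ insert z B := (Finset.mem_sdiff.1 (mem_coloops.1 hw).1).1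
    have hsub : ({(insert z B).erase w, (insert z B).erase w'} : Finset (Finset α)) ⊆
        (thinFacesOf M 5 G (insert z B)).filter (fun F => (G \ clF M F).card = 2) := by
      intro F hF
      rw [Finset.mem_insert, Finset.mem_singleton] at hF
      rw [Finset.mem_filter]
      rcases hF with rfl | rfl
      · exact ⟨hface w hw, by omega⟩
      · exact ⟨hface w' hw', by omega⟩
    have hc2 := Finset.card_le_card hsub
    rw [Finset.card_pair (herase_ne w w' hwQ hne)] at hc2
    omega
  -- the three products map injectively, with disjoint images, into the distance-2 targets
  have hwa := hmem wa (by simp)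
  have hwb := hmem wb (by simp)
  have hwc := hmem wc (by simp)
  have hpair : ∀ w ∈ coloops M (insert z B \ coloops M G), ∀ w' ∈ coloops M (insert z B \ coloops M G),
      w ≠ w' → ∀ p ∈ ((G \ clF M ((insert z B).erase w)).erase w) ×ˢ
        ((G \ clF M ((insert z B).erase w')).erase w'),
        insert p.1 (insert p.2 (insert z B)) ∈ d2Targets M 5 G (insert z B) := by
    intro w hw w' hw' hne p hp
    rw [Finset.mem_product] at hp
    have h1 := hAmem w hw p.1 hp.1
    have h2 := hAmem w' hw' p.2 hp.2
    have hwQ : w ∈ insert z B := (Finset.mem_sdiff.1 (mem_coloops.1 hw).1).1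
    have hne' : p.1 ≠ p.2 := by
      intro heq
      exact Finset.disjoint_left.1 (hAdisj w hw w' hw' hne) hp.1 (heq ▸ hp.2)
    exact mem_d2Targets.2 ⟨p, mem_d2Pts.2 ⟨⟨h1.1, h2.1⟩, hne', (insert z B).erase w, hface w hw,
      (insert z B).erase w', hface w' hw', herase_ne w w' hwQ hne, h1.2, h2.2⟩, rfl⟩
  have hinj : ∀ w ∈ coloops M (insert z B \ coloops M G), ∀ w' ∈ coloops M (insert z B \ coloops M G),
      w ≠ w' → Set.InjOn (fun p : α × α => insert p.1 (insert p.2 (insert z B)))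
        ((((G \ clF M ((insert z B).erase w)).erase w) ×ˢ ((G \ clF M ((insert z B).erase w')).erase w') :
          Finset (α × α)) : Set (α × α)) := by
    intro w hw w' hw' hne p hp q hq heq
    simp only [Finset.mem_coe, Finset.mem_product] at hp hq
    have hp1 := (hAmem w hw p.1 hp.1).1
    have hp2 := (hAmem w' hw' p.2 hp.2).1
    obtain ⟨h1, h2⟩ := pair_of_insert_insert_eq (Finset.mem_sdiff.1 hp1).2 (Finset.mem_sdiff.1 hp2).2 heq
    have hdisj := Finset.disjoint_left.1 (hAdisj w hw w' hw' hne)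
    rcases h1 with h1 | h1
    · rcases h2 with h2 | h2
      · have hx : p.2 = p.1 := h2.trans h1.symm
        rw [hx] at hp
        exact (hdisj hp.1 hp.2).elim
      · exact Prod.ext h1 h2
    · rw [h1] at hp
      exact (hdisj hp.1 hq.2).elim

  -- images of two products with a coordinate from different sets are disjoint
  have hdisj_img : ∀ w₁ ∈ coloops M (insert z B \ coloops M G), ∀ w₂ ∈ coloops M (insert z B \ coloops M G),
      ∀ w₃ ∈ coloops M (insert z B \ coloops M G), ∀ w₄ ∈ coloops M (insert z B \ coloops M G),
      w₁ ≠ w₂ → w₃ ≠ w₄ → ((w₁ ≠ w₃ ∧ w₁ ≠ w₄) ∨ (w₂ ≠ w₃ ∧ w₂ ≠ w₄)) →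
      Disjoint ((((G \ clF M ((insert z B).erase w₁)).erase w₁) ×ˢ
          ((G \ clF M ((insert z B).erase w₂)).erase w₂)).image
            (fun p : α × α => insert p.1 (insert p.2 (insert z B))))
        ((((G \ clF M ((insert z B).erase w₃)).erase w₃) ×ˢ
          ((G \ clF M ((insert z B).erase w₄)).erase w₄)).image
            (fun p : α × α => insert p.1 (insert p.2 (insert z B)))) := by
    intro w₁ hw₁ w₂ hw₂ w₃ hw₃ w₄ hw₄ h12 h34 hcase
    rw [Finset.disjoint_left]
    intro T hT hT'
    rw [Finset.mem_image] at hT hT'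
    obtain ⟨p, hp, rfl⟩ := hT
    obtain ⟨q, hq, heq⟩ := hT'
    rw [Finset.mem_product] at hp hq
    have hp1 := (hAmem w₁ hw₁ p.1 hp.1).1
    have hp2 := (hAmem w₂ hw₂ p.2 hp.2).1
    obtain ⟨h1, h2⟩ := pair_of_insert_insert_eq (Finset.mem_sdiff.1 hp1).2 (Finset.mem_sdiff.1 hp2).2 heq.symm
    rcases hcase with ⟨h13, h14⟩ | ⟨h23, h24⟩
    · rcases h1 with h1 | h1
      · rw [h1] at hp
        exact Finset.disjoint_left.1 (hAdisj w₁ hw₁ w₃ hw₃ h13) hp.1 hq.1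
      · rw [h1] at hp
        exact Finset.disjoint_left.1 (hAdisj w₁ hw₁ w₄ hw₄ h14) hp.1 hq.2
    · rcases h2 with h2 | h2
      · rw [h2] at hp
        exact Finset.disjoint_left.1 (hAdisj w₂ hw₂ w₃ hw₃ h23) hp.2 hq.1
      · rw [h2] at hp
        exact Finset.disjoint_left.1 (hAdisj w₂ hw₂ w₄ hw₄ h24) hp.2 hq.2
  -- assemble the three images
  have himg : ∀ w ∈ coloops M (insert z B \ coloops M G), ∀ w' ∈ coloops M (insert z B \ coloops M G),
      w ≠ w' → ((((G \ clF M ((insert z B).erase w)).erase w) ×ˢ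
        ((G \ clF M ((insert z B).erase w')).erase w')).image
          (fun p : α × α => insert p.1 (insert p.2 (insert z B)))).card =
        ((G \ clF M ((insert z B).erase w)).erase w).card * ((G \ clF M ((insert z B).erase w')).erase w').card := by
    intro w hw w' hw' hne
    rw [Finset.card_image_of_injOn (hinj w hw w' hw' hne), Finset.card_product]
  have hsubT : ∀ w ∈ coloops M (insert z B \ coloops M G), ∀ w' ∈ coloops M (insert z B \ coloops M G),
      w ≠ w' → (((G \ clF M ((insert z B).erase w)).erase w) ×ˢ
        ((G \ clF M ((insert z B).erase w')).erase w')).image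
          (fun p : α × α => insert p.1 (insert p.2 (insert z B))) ⊆ d2Targets M 5 G (insert z B) := by
    intro w hw w' hw' hne T hT
    rw [Finset.mem_image] at hT
    obtain ⟨p, hp, rfl⟩ := hT
    exact hpair w hw w' hw' hne p hp
  have hunion := Finset.union_subset (Finset.union_subset (hsubT wa hwa wb hwb hab) (hsubT wa hwa wc hwc hac))
    (hsubT wb hwb wc hwc hbc)
  have hcard := Finset.card_le_card hunion
  rw [Finset.card_union_of_disjoint, Finset.card_union_of_disjoint, himg wa hwa wb hwb hab, himg wa hwa wc hwc hac,
    himg wb hwb wc hwc hbc] at hcard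
  · refine le_trans ?_ hcard
    exact eight_le_sum_products_aux (hAge1 wa hwa) (hAge1 wb hwb) (hAge1 wc hwc) (hnot2 wa hwa wb hwb hab)
      (hnot2 wa hwa wc hwc hac) (hnot2 wb hwb wc hwc hbc)
  · exact hdisj_img wa hwa wb hwb wa hwa wc hwc hab hac (Or.inr ⟨hab.symm, hbc⟩)
  · rw [Finset.disjoint_union_left]
    exact ⟨hdisj_img wa hwa wb hwb wb hwb wc hwc hab hbc (Or.inl ⟨hab, hac⟩),
      hdisj_img wa hwa wc hwc wb hwb wc hwc hac hbc (Or.inl ⟨hab, hac⟩)⟩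

end PercRepro.Shadow
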